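import Mathlib
import Literature.AlgebraicGeometry.Resolution.CobordantGame
import Literature.AlgebraicGeometry.Resolution.CobordantVertexChart
import Summits.ResolutionOfSingularities.ResolutionOfSingularities.Theorems.WeightedInvariantLocalWeightedDropGradedSliceRank
import Summits.ResolutionOfSingularities.ResolutionOfSingularities.Theorems.WeightedInvariantLocalWeightedDropTwistedTrivialCylinder

/-!
# `WeightedInvariant.LocalWeightedDrop`: GRADED WINS LIFT TO CYLINDERS WITH THE SAME RANK — the cylinder lemma of the
# graded game

Route `ResolutionOfSingularities/WeightedInvariant`, crux `LocalWeightedDrop` (stmt-ResolutionOfSingularities-8899).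
[OURS · L1 W4.3] — CHAIN w43 SEAT TABLE v7 row res-type-060 «idea-1's graded slices».  After the probe of R3-T3
(`…GradedSliceRank` p507692, `…GradedSliceNoOneMoveWin` p508918, `…GradedSliceRankOne` p509095,
`…GradedFrobeniusLineObstruction` p510080, `…GradedFrobeniusLineRankOne` p510443) the surviving form of the slice statement is
ONE-SIDED («slice graded-won ⇒ successor graded-won, rank non-increasing»); in the TAME case the successor is a unit times a graded
coordinate change of the CYLINDER over its slice, so that statement factors through three transfers: cylinder, unit, graded
coordinate change.  This file proves the first: the cylinder transfer, for the cylinder `GradedGame.cylinder` of res-type-099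
(p509318, Sketch-L1-idea-1 v4 §9, imported by name).  Nothing here is a statement of the manuscript under review on ladder
RESOLUTION; not a verdict on card A.  AI proof, weaker than expert review.

* `cylLattice L` — the grading lattice of the cylinder: characters of `k[[y₁..yₘ, v]]` whose restriction to the old variables
  lies in `L` (the idle variable `v` has trivial character); `liftVec` — `u ↦ (u, 0)`.
* `succLattice_mono`, `GradedWonBy.mono_lattice` — a bigger lattice (smaller group, fewer constraints on the moves) wins at
  least as fast; `cylLattice_succLattice_le` — the cylinder of a propagated lattice sits inside the propagated lattice of the
  cylinder (weights `(w, 0)`, any value at the idle slot of the exceptional point).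
* `isLGradedMove_cylinder` — an `L`-graded move `(θ, w)` lifts to the `cylLattice L`-graded move `((cylinder ∘ θ, v), (w, 0))`
  (determinant by Laplace expansion along the idle row, as in p509318; gradedness because the cylinder has no exponent in `v`).
* `isSuccessorAt_of_cylinder` — SUCCESSORS OF A CYLINDER ARE CYLINDERS OF SUCCESSORS: under the lifted move, a singular
  `s`-saturated successor of `cylinder f` at `c̃` is `cylinder g` for a singular `s`-saturated successor `g` of `f` at
  `c̃|_{old}`, with the same exponent (the chart and the coordinate change commute with the cylinder: `subst_cylinder`,
  `cylinder_subst`, `cruxChart_snoc_castSucc`; uniqueness of the `s`-saturation `eq_of_X_pow_mul_eq`).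
* `gradedWonBy_cylinder` — **`GradedWonBy α m L f → GradedWonBy α (m+1) (cylLattice L) (cylinder f)`**, by transfinite
  induction on `α`.
-/

set_option linter.dupNamespace false -- mandated namespace of this single-conjunct summit
set_option autoImplicit false

namespace Summit.ResolutionOfSingularities.ResolutionOfSingularities.Theorems

namespace GradedGame

open MvPowerSeries
open Literature.AlgebraicGeometry.Resolution

variable {k : Type} [Field k]

/-! ## §1 Lattice bookkeeping -/

/-- The CYLINDER LATTICE: characters of `k[[y₁..yₘ, v]]` whose restriction to the old variables lies in `L`; the idle variable
`v` has trivial character. [OURS · L1 W4.3] -/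
def cylLattice {m : ℕ} (L : AddSubgroup (Fin m → ℤ)) : AddSubgroup (Fin (m + 1) → ℤ) :=
  L.comap (LinearMap.funLeft ℤ ℤ (Fin.castSucc : Fin m → Fin (m + 1))).toAddMonoidHom

/-- Membership in the cylinder lattice. [OURS · L1 W4.3] -/
theorem mem_cylLattice_iff {m : ℕ} (L : AddSubgroup (Fin m → ℤ)) (v : Fin (m + 1) → ℤ) :
    v ∈ cylLattice L ↔ (fun j => v (Fin.castSucc j)) ∈ L :=
  Iff.rfl

/-- The successor lattice is monotone in the grading lattice. [OURS · L1 W4.3] -/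
theorem succLattice_mono {m : ℕ} {L L' : AddSubgroup (Fin m → ℤ)} (h : L ≤ L') (w : Fin m → ℕ) (c : Fin m → k) :
    succLattice L w c ≤ succLattice L' w c := by
  unfold succLattice
  refine AddSubgroup.closure_mono (Set.union_subset_union_left _ ?_)
  rintro v ⟨r, hr, hv⟩
  exact ⟨r, h hr, hv⟩

/-- GRADED RANKS ARE MONOTONE IN THE LATTICE: a bigger lattice (a smaller group, fewer constraints on the moves) wins at least as
fast. [OURS · L1 W4.3] -/
theorem GradedWonBy.mono_lattice (α : Ordinal.{0}) :
    ∀ {m : ℕ} {L L' : AddSubgroup (Fin m → ℤ)} (_ : L ≤ L') {f : MvPowerSeries (Fin m) k},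
      GradedWonBy α m L f → GradedWonBy α m L' f := by
  induction α using WellFoundedLT.induction with
  | ind α ih =>
    intro m L L' hLL f h
    rw [gradedWonBy_iff] at h ⊢
    obtain ⟨θ, w, ⟨hmv, hgr⟩, hs⟩ := h
    refine ⟨θ, w, ⟨hmv, fun i e he => hLL (hgr i e he)⟩, fun c a g hg => ?_⟩
    obtain ⟨β, hβ, hW⟩ := hs c a g hg
    exact ⟨β, hβ, ih β hβ (succLattice_mono hLL w c) hW⟩

/-- Lift of a character vector to the cylinder: `0` in the idle slot. [OURS · L1 W4.3] -/
def liftVec (m : ℕ) : (Fin m → ℤ) →+ (Fin (m + 1) → ℤ) where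
  toFun u := Fin.snoc u 0
  map_zero' := by
    funext i
    refine Fin.lastCases ?_ (fun j => ?_) i
    · simp
    · simp
  map_add' u v := by
    funext i
    refine Fin.lastCases ?_ (fun j => ?_) i
    · simp
    · simp

/-- Components of the lift. [OURS · L1 W4.3] -/
theorem liftVec_apply {m : ℕ} (u : Fin m → ℤ) (i : Fin (m + 1)) :
    liftVec m u i = Fin.snoc (α := fun _ => ℤ) u 0 i := rfl

/-- THE CYLINDER OF A SUCCESSOR LATTICE SITS INSIDE THE SUCCESSOR LATTICE OF THE CYLINDER (weights `0` and any value `c̃(v)`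
at the idle variable). [OURS · L1 W4.3] -/
theorem cylLattice_succLattice_le {m : ℕ} (L : AddSubgroup (Fin m → ℤ)) (w : Fin m → ℕ) (c' : Fin (m + 1) → k) :
    cylLattice (succLattice L w (fun j => c' (Fin.castSucc j))) ≤
      succLattice (cylLattice L) (Fin.snoc w 0 : Fin (m + 1) → ℕ) c' := by
  classical
  intro v hv
  rw [mem_cylLattice_iff] at hv
  set R := succLattice (cylLattice L) (Fin.snoc w 0 : Fin (m + 1) → ℕ) c' with hR
  -- the idle unit vector lies in `R` (first kind of generator with `r = e_last`)
  have hlast : (Pi.single (Fin.last (m + 1)) 1 : Fin (m + 1 + 1) → ℤ) ∈ R := by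
    refine AddSubgroup.subset_closure (Or.inl ⟨Pi.single (Fin.last m) 1, ?_, ?_⟩)
    · rw [mem_cylLattice_iff]
      have : (fun j : Fin m => (Pi.single (Fin.last m) (1 : ℤ) : Fin (m + 1) → ℤ) (Fin.castSucc j)) = 0 := by
        funext j; simp [(Fin.castSucc_lt_last j).ne]
      rw [this]; exact L.zero_mem
    · funext i
      refine Fin.cases ?_ (fun j => ?_) i
      · simp only [Matrix.cons_val_zero]
        rw [Finset.sum_eq_single (Fin.last m)]
        · simp
        · intro b _ hb; simp [hb]
        · intro h; exact absurd (Finset.mem_univ _) h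
      · simp only [Matrix.cons_val_succ]
        rw [← Fin.succ_last]
        by_cases hj : j = Fin.last m
        · subst hj; simp
        · rw [Pi.single_eq_of_ne hj, Pi.single_eq_of_ne (fun h => hj (Fin.succ_injective _ h))]
  -- the lift of the generators of `succLattice L w c` lies in `R`
  have hgen : succLattice L w (fun j => c' (Fin.castSucc j)) ≤ R.comap (liftVec (m + 1)) := by
    unfold succLattice
    rw [AddSubgroup.closure_le]
    rintro u (⟨r, hr, rfl⟩ | ⟨j, hcj, hwj, rfl⟩)
    · -- `(w·r ; r)` lifts to `(w̃·r̃ ; r̃)` with `r̃ = (r, 0)`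
      rw [SetLike.mem_coe, AddSubgroup.mem_comap]
      refine AddSubgroup.subset_closure (Or.inl ⟨Fin.snoc r 0, ?_, ?_⟩)
      · rw [mem_cylLattice_iff]
        have : (fun j : Fin m => (Fin.snoc r (0 : ℤ) : Fin (m + 1) → ℤ) (Fin.castSucc j)) = r := by
          funext j; simp
        rw [this]; exact hr
      · rw [Fin.sum_univ_castSucc]
        simp only [Fin.snoc_castSucc, Fin.snoc_last, Nat.cast_zero, zero_mul, add_zero]
        funext i
        rw [liftVec_apply]
        exact (congrFun (Fin.cons_snoc_eq_snoc_cons (∑ j, (w j : ℤ) * r j) r (0 : ℤ)) i).symm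
    · -- `e_{j+1}` lifts to `e_{castSucc j + 1}`
      rw [SetLike.mem_coe, AddSubgroup.mem_comap]
      refine AddSubgroup.subset_closure (Or.inr ⟨Fin.castSucc j, hcj, by simpa using hwj, ?_⟩)
      funext i
      rw [liftVec_apply]
      refine Fin.lastCases ?_ (fun l => ?_) i
      · rw [Fin.snoc_last, Pi.single_eq_of_ne]
        rw [Fin.succ_castSucc]
        exact (Fin.castSucc_lt_last _).ne'
      · rw [Fin.snoc_castSucc, Fin.succ_castSucc]
        by_cases hl : l = j.succ
        · subst hl; simp
        · rw [Pi.single_eq_of_ne hl, Pi.single_eq_of_ne (fun h => hl (Fin.castSucc_injective _ h))]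
  -- decompose `v` into its lift and its idle component
  have hdec : v = liftVec (m + 1) (fun j => v (Fin.castSucc j)) + v (Fin.last (m + 1)) • (Pi.single (Fin.last (m + 1)) 1 :
      Fin (m + 1 + 1) → ℤ) := by
    funext i
    refine Fin.lastCases ?_ (fun l => ?_) i
    · simp [liftVec]
    · simp [liftVec, (Fin.castSucc_lt_last l).ne]
  rw [hdec]
  exact R.add_mem (hgen hv) (R.zsmul_mem hlast _)

/-! ## §2 The lifted move: cylinders of the coordinate change, the idle variable kept with weight `0` -/

/-- The lifted coordinate change has zero constant terms. [OURS · L1 W4.3] -/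
theorem constantCoeff_cylMove {m : ℕ} {θ : Fin m → MvPowerSeries (Fin m) k} (h0 : ∀ i, constantCoeff (θ i) = 0)
    (j : Fin (m + 1)) :
    constantCoeff ((Fin.snoc (fun i => cylinder (θ i)) (X (Fin.last m)) : Fin (m + 1) → MvPowerSeries (Fin (m + 1)) k) j) = 0 := by
  refine Fin.lastCases ?_ (fun l => ?_) j
  · simp only [Fin.snoc_last]; exact constantCoeff_X _
  · simp only [Fin.snoc_castSucc]; exact constantCoeff_cylinder_eq_zero (h0 l)

/-- An exponent of `k[[y, v]]` not involving the idle variable `v` is the image exponent of its restriction.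
[OURS · L1 W4.3] -/
theorem eq_linExp_cylExp_of_last_eq_zero {m : ℕ} (e : Fin (m + 1) →₀ ℕ) (he : e (Fin.last m) = 0) :
    e = linExp (cylExp m) (Finsupp.equivFunOnFinite.symm fun j => e (Fin.castSucc j)) := by
  ext j
  refine Fin.lastCases ?_ (fun l => ?_) j
  · rw [linExp_cylExp_last, he]
  · rw [linExp_cylExp_castSucc]; simp

/-- **A GRADED MOVE LIFTS TO THE CYLINDER**: `(cylinder ∘ θ, v)` with weights `(w, 0)` is a `cylLattice L`-graded move
whenever `(θ, w)` is `L`-graded (determinant: Laplace expansion along the idle row). [OURS · L1 W4.3] -/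
theorem isLGradedMove_cylinder {m : ℕ} {L : AddSubgroup (Fin m → ℤ)} {θ : Fin m → MvPowerSeries (Fin m) k}
    {w : Fin m → ℕ} (h : IsLGradedMove L θ w) :
    IsLGradedMove (cylLattice L) (Fin.snoc (fun i => cylinder (θ i)) (X (Fin.last m))) (Fin.snoc w 0) := by
  classical
  obtain ⟨⟨h0, hdet, ⟨i, hi⟩⟩, hgr⟩ := h
  refine ⟨⟨constantCoeff_cylMove h0, ?_, ⟨Fin.castSucc i, by simpa using hi⟩⟩, ?_⟩
  · -- the determinant
    set M : Matrix (Fin m) (Fin m) k := Matrix.of fun a b => coeff (Finsupp.single b 1) (θ a) with hM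
    set M' : Matrix (Fin (m + 1)) (Fin (m + 1)) k := Matrix.of fun a b => coeff (Finsupp.single b 1)
      ((Fin.snoc (fun i => cylinder (θ i)) (X (Fin.last m)) : Fin (m + 1) → MvPowerSeries (Fin (m + 1)) k) a) with hM'
    have hlast : ∀ b, M' (Fin.last m) b = if b = Fin.last m then 1 else 0 := by
      intro b
      simp only [hM', Matrix.of_apply, Fin.snoc_last, coeff_X]
      by_cases hb : b = Fin.last m
      · subst hb; simp
      · rw [if_neg hb, if_neg]
        intro h'
        exact hb ((Finsupp.single_left_inj one_ne_zero).mp h')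
    have hsub : M'.submatrix (Fin.last m).succAbove (Fin.last m).succAbove = M := by
      ext a b
      simp only [Matrix.submatrix_apply, Fin.succAbove_last, hM', hM, Matrix.of_apply, Fin.snoc_castSucc]
      exact coeff_single_castSucc_cylinder (θ a) b
    have hdet' : M'.det = M.det := by
      rw [Matrix.det_succ_row M' (Fin.last m), Finset.sum_eq_single (Fin.last m)]
      · rw [hlast, if_pos rfl, hsub, mul_one, Even.neg_one_pow ⟨(Fin.last m : ℕ), rfl⟩, one_mul]
      · intro b _ hb
        rw [hlast, if_neg hb, mul_zero, zero_mul]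
      · intro h; exact absurd (Finset.mem_univ _) h
    change IsUnit M'.det
    rw [hdet']
    exact hdet
  · -- gradedness
    intro j
    refine Fin.lastCases ?_ (fun l => ?_) j
    · intro e he
      simp only [Fin.snoc_last] at he
      rw [coeff_X] at he
      have hej : e = Finsupp.single (Fin.last m) 1 := by
        by_contra hne
        exact he (if_neg hne)
      subst hej
      rw [expVec_single, Nat.cast_one, sub_self]
      exact AddSubgroup.zero_mem _
    · intro e he
      simp only [Fin.snoc_castSucc] at he
      have he0 : e (Fin.last m) = 0 := by
        by_contra hne
        exact he (coeff_cylinder_eq_zero (θ l) e hne)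
      set d : Fin m →₀ ℕ := Finsupp.equivFunOnFinite.symm fun j => e (Fin.castSucc j) with hd
      have hed : e = linExp (cylExp m) d := eq_linExp_cylExp_of_last_eq_zero e he0
      have hcoef : coeff d (θ l) ≠ 0 := by rwa [hed, coeff_cylinder] at he
      have hmem := hgr l d hcoef
      rw [mem_cylLattice_iff]
      have hfun : (fun j => (expVec e - Pi.single (Fin.castSucc l) 1 : Fin (m + 1) → ℤ) (Fin.castSucc j)) =
          expVec d - Pi.single l 1 := by
        funext j
        simp only [Pi.sub_apply, expVec, hd, Finsupp.coe_equivFunOnFinite_symm]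
        by_cases hj : j = l
        · subst hj; simp
        · rw [Pi.single_eq_of_ne hj, Pi.single_eq_of_ne (fun h => hj (Fin.castSucc_injective _ h))]
      rw [hfun]
      exact hmem

/-- The cylinder of zero. [OURS · L1 W4.3] -/
theorem cylinder_zero (m : ℕ) : cylinder (0 : MvPowerSeries (Fin m) k) = 0 := by
  rw [cylinder, ← coe_substAlgHom (hasSubst_cylinderFamily m), map_zero]

/-- The cylinder of a power of the exceptional variable. [OURS · L1 W4.3] -/
theorem cylinder_X_zero_pow (m b : ℕ) : cylinder ((X (0 : Fin (m + 1))) ^ b : MvPowerSeries (Fin (m + 1)) k) = X 0 ^ b := by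
  rw [cylinder, subst_pow (hasSubst_cylinderFamily (m + 1)), subst_X (hasSubst_cylinderFamily (m + 1)), Fin.castSucc_zero]

/-- `s ∤ g ⇒ s ∤ cylinder g`. [OURS · L1 W4.3] -/
theorem not_X_dvd_cylinder {m : ℕ} {g : MvPowerSeries (Fin (m + 1)) k} (hg : ¬ X 0 ∣ g) : ¬ X 0 ∣ cylinder g := by
  rw [X_dvd_iff] at hg ⊢
  push Not at hg ⊢
  obtain ⟨μ, hμ0, hμ⟩ := hg
  refine ⟨linExp (cylExp (m + 1)) μ, ?_, by rwa [coeff_cylinder]⟩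
  rw [← Fin.castSucc_zero, linExp_cylExp_castSucc]
  exact hμ0

/-- The crux's chart of the lifted move is, on the old variables, the cylinder of the crux's chart. [OURS · L1 W4.3] -/
theorem cruxChart_snoc_castSucc {m : ℕ} (w : Fin m → ℕ) (c' : Fin (m + 1) → k) (j : Fin m) :
    CobordantGame.cruxChart k (Fin.snoc w 0 : Fin (m + 1) → ℕ) c' (Fin.castSucc j) =
      cylinder (CobordantGame.cruxChart k w (fun j => c' (Fin.castSucc j)) j) := by
  have hcyl := hasSubst_cylinderFamily (k := k) (m + 1)
  unfold CobordantGame.cruxChart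
  rw [Fin.snoc_castSucc]
  by_cases hw : 0 < w j
  · rw [if_pos hw, if_pos hw, cylinder, subst_mul hcyl, subst_pow hcyl, subst_add hcyl, subst_C, subst_X hcyl,
      subst_X hcyl, Fin.castSucc_zero, Fin.succ_castSucc]
  · rw [if_neg hw, if_neg hw, cylinder, subst_X hcyl, Fin.succ_castSucc]

/-- **SUCCESSORS OF A CYLINDER ARE CYLINDERS OF SUCCESSORS** (same exceptional point on the old coordinates, same exponent
`a`; uniqueness of the `s`-saturation). [OURS · L1 W4.3] -/
theorem isSuccessorAt_of_cylinder {m : ℕ} (f : MvPowerSeries (Fin m) k) (θ : Fin m → MvPowerSeries (Fin m) k)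
    (w : Fin m → ℕ) (h0 : ∀ i, constantCoeff (θ i) = 0) (c' : Fin (m + 1) → k) (a : ℕ)
    (g' : MvPowerSeries (Fin (m + 1 + 1)) k)
    (h : IsSuccessorAt (cylinder f) (Fin.snoc (fun i => cylinder (θ i)) (X (Fin.last m))) (Fin.snoc w 0) c' a g') :
    ∃ g : MvPowerSeries (Fin (m + 1)) k, IsSuccessorAt f θ w (fun j => c' (Fin.castSucc j)) a g ∧ g' = cylinder g := by
  obtain ⟨⟨i', hwi', hci'⟩, hfac, hndvd, hc0, hc1⟩ := h
  have hθs : HasSubst θ := hasSubst_of_constantCoeff_zero h0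
  have hθ's : HasSubst (Fin.snoc (fun i => cylinder (θ i)) (X (Fin.last m)) : Fin (m + 1) → MvPowerSeries (Fin (m + 1)) k) :=
    hasSubst_of_constantCoeff_zero (constantCoeff_cylMove h0)
  have hC := hasSubst_cruxChart (k := k) w (fun j => c' (Fin.castSucc j))
  have hC' := hasSubst_cruxChart (k := k) (Fin.snoc w 0 : Fin (m + 1) → ℕ) c'
  -- transport of the two substitutions through the cylinder
  have step1 : subst (Fin.snoc (fun i => cylinder (θ i)) (X (Fin.last m)) : Fin (m + 1) → MvPowerSeries (Fin (m + 1)) k)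
      (cylinder f) = cylinder (subst θ f) := by
    rw [subst_cylinder hθ's, cylinder_subst hθs]
    congr 1
    funext j
    simp only [Fin.snoc_castSucc]
  have step2 : ∀ F : MvPowerSeries (Fin m) k,
      subst (CobordantGame.cruxChart k (Fin.snoc w 0 : Fin (m + 1) → ℕ) c') (cylinder F) =
        cylinder (subst (CobordantGame.cruxChart k w (fun j => c' (Fin.castSucc j))) F) := by
    intro F
    rw [subst_cylinder hC', cylinder_subst hC]
    congr 1
    funext j
    exact cruxChart_snoc_castSucc w c' j
  rw [step1, step2] at hfac
  set T := subst (CobordantGame.cruxChart k w (fun j => c' (Fin.castSucc j))) (subst θ f) with hT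
  have hTne : T ≠ 0 := by
    intro hz
    rw [hz, cylinder_zero] at hfac
    have hg' : g' = 0 := by
      rcases mul_eq_zero.mp hfac.symm with h1 | h1
      · exact absurd h1 (pow_ne_zero _ X_zero_ne_zero)
      · exact h1
    exact hndvd (hg' ▸ dvd_zero _)
  obtain ⟨b, g, hTfac, hg⟩ := CobordantVertexChart.exists_eq_X_pow_mul_not_dvd hTne
  have hcylT : cylinder T = X 0 ^ b * cylinder g := by rw [hTfac, cylinder_mul, cylinder_X_zero_pow]
  obtain ⟨hab, hgg⟩ := eq_of_X_pow_mul_eq (hcylT.symm.trans hfac) (not_X_dvd_cylinder hg) hndvd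
  refine ⟨g, ⟨?_, ?_, hg, ?_, ?_⟩, hgg.symm⟩
  · -- off the vertex: the idle variable has weight `0`
    have hne : i' ≠ Fin.last m := by
      rintro rfl
      simp at hwi'
    obtain ⟨l, rfl⟩ := Fin.exists_castSucc_eq.mpr hne
    exact ⟨l, by simpa using hwi', hci'⟩
  · rw [← hab]; exact hTfac
  · have h := hc0
    rw [← hgg, ← coeff_zero_eq_constantCoeff_apply,
      show (0 : Fin (m + 1 + 1) →₀ ℕ) = linExp (cylExp (m + 1)) 0 by simp [linExp], coeff_cylinder,
      coeff_zero_eq_constantCoeff_apply] at h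
    exact h
  · intro j
    have h := hc1 (Fin.castSucc j)
    rwa [← hgg, coeff_single_castSucc_cylinder] at h

/-! ## §3 The cylinder lemma -/

/-- **GRADED WINS LIFT TO CYLINDERS, WITH THE SAME RANK**: if `f` is won in the `L`-graded game with rank `α`, then its cylinder
`f ⊗ 1 ∈ k[[y₁..yₘ, v]]` is won in the `cylLattice L`-graded game with rank `α` — play the cylinders of the winning moves with
weight `0` on the idle variable; every singular successor of the cylinder is the cylinder of a singular successor
(`isSuccessorAt_of_cylinder`), its propagated lattice contains the cylinder of the propagated lattice
(`cylLattice_succLattice_le`), and graded ranks are monotone in the lattice (`GradedWonBy.mono_lattice`); transfinite induction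
on `α`.  First third of the surviving one-sided slice statement «slice graded-won ⇒ successor graded-won» (tame case = cylinder
+ unit + graded coordinate change). [OURS · L1 W4.3] -/
theorem gradedWonBy_cylinder (α : Ordinal.{0}) :
    ∀ {m : ℕ} (L : AddSubgroup (Fin m → ℤ)) (f : MvPowerSeries (Fin m) k),
      GradedWonBy α m L f → GradedWonBy α (m + 1) (cylLattice L) (cylinder f) := by
  induction α using WellFoundedLT.induction with
  | ind α ih =>
    intro m L f h
    rw [gradedWonBy_iff] at h ⊢
    obtain ⟨θ, w, hθ, hs⟩ := h
    refine ⟨Fin.snoc (fun i => cylinder (θ i)) (X (Fin.last m)), Fin.snoc w 0, isLGradedMove_cylinder hθ, ?_⟩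
    intro c' a g' hg'
    obtain ⟨g, hg, rfl⟩ := isSuccessorAt_of_cylinder f θ w hθ.1.1 c' a g' hg'
    obtain ⟨β, hβ, hW⟩ := hs _ a g hg
    exact ⟨β, hβ, GradedWonBy.mono_lattice β (cylLattice_succLattice_le L w c') (ih β hβ _ g hW)⟩

end GradedGame

end Summit.ResolutionOfSingularities.ResolutionOfSingularities.Theorems
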